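import Summits.QuantumFields.GaugeBoot.TiltedBoxLimitGeometry
import Summits.QuantumFields.GaugeBoot.PeriodicLoopEquationPairForm
import Summits.QuantumFields.GaugeBoot.WordLoopZdLimit
import HarnessLib

/-!
# Infinite-volume limit points of the 45°-tilted boxes, part 14: the loop equations hold exactly

HONEST FRAMING (cell `pub-gaugeboot`, page 1 of every file): the venture produces certified bounds
on lattice expectations at stated coupling, gauge group, dimension and torus size; NOT a mass gap,
NOT a continuum limit, NOT a string tension; NOT Yang–Mills-summit-bearing (barriers
`FixedCouplingUltralocality`, `PerturbativeInvisibility`). A structural fact about a class of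
infinite-volume Wilson states (which loop equations are exact for them); nothing else is claimed.

## Content

**`loopEquation_pairForm_suN_of_mem_tiltedBoxLimitPoints`.** For `G = SU(N)` (fundamental
representation), every real `β`, every tilted limit point `μ ∈ tiltedBoxLimitPoints d i j ρ β`
(`i ≠ j`), every site `x ∈ ℤ^d`, axis `a` and word `w` closed at `x` on `ℤ^d`: the single-link loop
(Schwinger–Dyson / Makeenko–Migdal) equation in the REAL PAIR normal form of
`PeriodicLoopEquationPairForm.lean` holds for `μ`, with the `ℤ^d` word holonomies `wordHolonomyZd` of
`ClassBWords.lean` — verbatim the identity `loopEquation_pairForm_specialUnitaryGroup` of the boxes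
with `∫ … ∂μ` in place of the box expectations.

Proof: on each box of the defining family the identity holds for the projected base point `[x]` as
soon as the word is small for the box (`smallFor_tiltedUnit_of_dispBound`; every word has displacement
bound its length, `dispBound_length`, so this is eventually the case); box word holonomies at `[x]`
are `ℤ^d` word holonomies of the lift (`wordHolonomy_mk`), every term is the real part of the box
expectation of a bounded continuous complex cylinder observable read through the lift, and these
converge (`IsTiltedBoxLimitAlong.tendsto_re_integral`); a finite combination of convergent sequences
that vanishes eventually has limit `0`.

So the `H`-side of a loop-equation SDP (Gram positivity, `sum_mul_integral_wordLoopZd_nonneg` of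
`ClassBWords.lean`, and these loop equations) is exact for every tilted limit point, like the `R`-side
(`TiltedBoxLimitDiagonalRP`, `…AxisRP`, `…AntiDiagonalRP`). For general Class-B / Haar-shift states
the `ℤ^d` loop equations are not derived here (that needs the word calculus over `LGConfig`).
UPDATE (2026-08-28): they are now — `ZdLoopEquationStates.lean`, `IsHaarShiftState.loopEquation_pairForm_suN`
/ `_uN` (every Haar-shift state; the Haar-shift identity alone suffices, no limit procedure), with the
corollaries `TiltedRP.TiltedClassState.loopEquation_pairForm_suN` / `_uN` for every Class-T state; the
theorem below is the special case of a tilted limit point (`isHaarShiftState_of_mem_tiltedBoxLimitPoints`),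
kept with its original proof by limits.

References: Yu. Makeenko, A. Migdal, Phys. Lett. B 88 (1979) 135; S. Chatterjee, Comm. Math. Phys.
366 (2019) Thm. 8.1; P. Anderson, M. Kruczenski, Nucl. Phys. B 921 (2017) §2.2; V. Kazakov, Z. Zheng,
JHEP 03 (2025) 099 §2.3 (2.26)–(2.31).
-/

noncomputable section

open MeasureTheory Filter Topology
open Literature.Probability.LatticeModels (Site)
open Literature.MathematicalPhysics.QuantumLattice

namespace Summit.QuantumFields.GaugeBoot

namespace TiltedRP

/-! ## Words on the box versus words on `ℤ^d` -/

section Words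

variable (d : ℕ) (i j : Fin d) (Mu Mv L : ℕ) {G : Type*}

/-- A step from `[x]` on the box ends at the class of the `ℤ^d` endpoint. -/
theorem move_mk (s : Step d) (x : Site d) :
    s.move (tiltedUnit d i j Mu Mv L) (x : TiltedSite d i j Mu Mv L) =
      ((s.applyZd x : Site d) : TiltedSite d i j Mu Mv L) := by
  cases s with
  | fwd m => rw [Step.move_fwd, Step.applyZd_fwd, mk_add_single]
  | bwd m => rw [Step.move_bwd, Step.applyZd_bwd, mk_sub_single]

/-- A word from `[x]` on the box ends at the class of the `ℤ^d` endpoint. -/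
theorem endpoint_mk (x : Site d) (w : Word d) :
    Word.endpoint (tiltedUnit d i j Mu Mv L) (x : TiltedSite d i j Mu Mv L) w =
      ((GaugeBoot.Word.endpointZd x w : Site d) : TiltedSite d i j Mu Mv L) := by
  induction w generalizing x with
  | nil => rfl
  | cons s w ih => rw [Word.endpoint_cons, GaugeBoot.Word.endpointZd_cons, move_mk, ih]

variable [Group G]

/-- **Box step holonomies at a class are `ℤ^d` step holonomies of the lift.** -/
theorem stepHolonomy_mk (V : Config (TiltedSite d i j Mu Mv L) d G) (x : Site d) (s : Step d) :
    stepHolonomy (tiltedUnit d i j Mu Mv L) V (x : TiltedSite d i j Mu Mv L) s =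
      stepHolonomyZd (tiltedLift d i j Mu Mv L V) x s := by
  cases s with
  | fwd m => rfl
  | bwd m => rw [stepHolonomy_bwd, stepHolonomyZd_bwd, tiltedLift_apply, mk_sub_single]

/-- **Box word holonomies at a class are `ℤ^d` word holonomies of the lift.** -/
theorem wordHolonomy_mk (V : Config (TiltedSite d i j Mu Mv L) d G) (x : Site d) (w : Word d) :
    wordHolonomy (tiltedUnit d i j Mu Mv L) V (x : TiltedSite d i j Mu Mv L) w =
      wordHolonomyZd (tiltedLift d i j Mu Mv L V) x w := by
  induction w generalizing x with
  | nil => rfl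
  | cons s w ih => rw [wordHolonomy_cons, wordHolonomyZd_cons, stepHolonomy_mk, move_mk, ih]

omit [Group G] in
/-- A partial displacement of a word has sup-norm at most the number of letters read. -/
theorem natAbs_dispZ_le (w : Word d) : ∀ (k : ℕ) (m : Fin d), (w.dispZ k m).natAbs ≤ k := by
  induction w with
  | nil => intro k m; simp
  | cons s w ih =>
    intro k m
    cases k with
    | zero => simp
    | succ k =>
      rw [GaugeBoot.Word.dispZ_cons_succ, Pi.add_apply]
      have h1 : (s.dispZ m).natAbs ≤ 1 := by
        cases s with
        | fwd a => by_cases hm : m = a <;> simp [Step.dispZ, hm]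
        | bwd a => by_cases hm : m = a <;> simp [Step.dispZ, hm]
      have h2 := ih k m
      have h3 := Int.natAbs_add_le (s.dispZ m) (GaugeBoot.Word.dispZ w k m)
      omega

omit [Group G] in
/-- **Every word has displacement bound its length.** -/
theorem dispBound_length (w : Word d) : w.DispBound w.length :=
  fun k hk m => (natAbs_dispZ_le d w k m).trans hk

end Words

/-! ## Real parts of complex cylinder expectations converge -/

section ReLimit

variable {d : ℕ} {i j : Fin d} {N : ℕ}
variable {G : Type*} [Group G] [TopologicalSpace G] [IsTopologicalGroup G] [CompactSpace G]
  [MeasurableSpace G] [BorelSpace G] [SecondCountableTopology G]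
variable {ρ : G →* Matrix (Fin N) (Fin N) ℂ} {β : ℝ} {M Q : ℕ → ℕ} {μ : Measure (LGConfig d G)}

/-- **Real parts of box expectations of a bounded continuous complex cylinder observable converge**
along a tilted family to the real part of its `μ`-expectation. -/
theorem IsTiltedBoxLimitAlong.tendsto_re_integral (hρ : Continuous ρ)
    (h : IsTiltedBoxLimitAlong d i j ρ β M Q μ) {H : LGConfig d G → ℂ} {T : Finset (ZdEdge d)}
    (hHT : IsCylinder H T) (hHc : Continuous H) {C : ℝ} (hC : ∀ U, ‖H U‖ ≤ C) :
    Tendsto (fun k : ℕ => (∫ V, H (tiltedLift d i j (M k + 2) (M k + 2) (2 * (Q k + 2)) V)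
      ∂(gibbs ρ (tiltedUnit d i j (M k + 2) (M k + 2) (2 * (Q k + 2))) β)).re) atTop
      (𝓝 (∫ U, H U ∂μ).re) := by
  haveI := h.1
  have hre := h.tendsto_integral (F := fun U => (H U).re) (S := T)
    (fun U V hUV => by simp only [hHT hUV]) (Complex.continuous_re.comp hHc)
    (C := C) fun U => (Complex.abs_re_le_norm _).trans (hC U)
  have hint : Integrable H μ :=
    Integrable.of_bound hHc.measurable.aestronglyMeasurable C (ae_of_all _ hC)
  have e0 : (∫ U, H U ∂μ).re = ∫ U, (H U).re ∂μ := by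
    have e := integral_re hint
    simp only [RCLike.re_to_complex] at e
    exact e.symm
  rw [e0]
  refine hre.congr' (Eventually.of_forall fun k => ?_)
  haveI := isProbabilityMeasure_gibbs (A := TiltedSite d i j (M k + 2) (M k + 2) (2 * (Q k + 2)))
    (G := G) ρ hρ (tiltedUnit d i j (M k + 2) (M k + 2) (2 * (Q k + 2))) β
  have hintk : Integrable (fun V => H (tiltedLift d i j (M k + 2) (M k + 2) (2 * (Q k + 2)) V))
      (gibbs ρ (tiltedUnit d i j (M k + 2) (M k + 2) (2 * (Q k + 2))) β) :=
    Integrable.of_bound ((hHc.comp (continuous_tiltedLift _ _ _ _ _ _)).measurable.aestronglyMeasurable)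
      C (ae_of_all _ fun V => hC _)
  have e := integral_re hintk
  simp only [RCLike.re_to_complex] at e
  exact e

end ReLimit

/-! ## The loop equations of the tilted limit points (`SU(N)`) -/

section LoopEquation

variable {d N : ℕ} {i j : Fin d}

/-- **THE `SU(N)` SINGLE-LINK LOOP EQUATION IN REAL PAIR NORMAL FORM HOLDS FOR EVERY TILTED LIMIT
POINT** (`i ≠ j`, every real `β`, every `N`; `w` a word closed at `x` on `ℤ^d`, `a` the axis of the
link `(x, a)`): the identity `loopEquation_pairForm_specialUnitaryGroup` with the `ℤ^d` word
holonomies and `∫ … ∂μ`. -/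
theorem loopEquation_pairForm_suN_of_mem_tiltedBoxLimitPoints (hij : i ≠ j) (x : Site d) (a : Fin d)
    (w : Word d) (hw : GaugeBoot.Word.endpointZd x w = x) {β : ℝ}
    {μ : Measure (LGConfig d (Matrix.specialUnitaryGroup (Fin N) ℂ))}
    (hμ : μ ∈ tiltedBoxLimitPoints d i j (fundamentalRep (Fin N)) β) :
    (∑ k ∈ (Finset.range w.length).filter (w.fwdOccZ a),
        ((∫ U, (fundamentalRep (Fin N) (wordHolonomyZd U x (w.take k))).trace *
              (fundamentalRep (Fin N) (wordHolonomyZd U x (w.drop k))).trace ∂μ).re / (N : ℝ) ^ 2 -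
          (N : ℝ)⁻¹ * (∫ U, (fundamentalRep (Fin N) (wordHolonomyZd U x w)).trace ∂μ).re / (N : ℝ) ^ 2)) -
      (∑ k ∈ (Finset.range w.length).filter (w.bwdOccZ a),
        ((∫ U, (fundamentalRep (Fin N) (wordHolonomyZd U x (w.take (k + 1)))).trace *
              (fundamentalRep (Fin N) (wordHolonomyZd U x (w.drop (k + 1)))).trace ∂μ).re / (N : ℝ) ^ 2 -
          (N : ℝ)⁻¹ * (∫ U, (fundamentalRep (Fin N) (wordHolonomyZd U x w)).trace ∂μ).re / (N : ℝ) ^ 2)) +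
      β / (2 * N) * ∑ ν ∈ Finset.univ.erase a, ∑ ε : Bool,
        ((N : ℝ)⁻¹ * (∫ U, (fundamentalRep (Fin N) (wordHolonomyZd U x (w ++ plaqWord a ν ε))).trace ∂μ).re -
          (N : ℝ)⁻¹ * (∫ U, (fundamentalRep (Fin N)
            (wordHolonomyZd U x (w ++ (plaqWord a ν ε).reverse))).trace ∂μ).re -
          ((∫ U, (fundamentalRep (Fin N) (wordHolonomyZd U x w)).trace *
                (fundamentalRep (Fin N) (wordHolonomyZd U x (plaqWord a ν ε))).trace ∂μ).re / (N : ℝ) ^ 2 -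
            (∫ U, (fundamentalRep (Fin N) (wordHolonomyZd U x w)).trace *
                (fundamentalRep (Fin N) (wordHolonomyZd U x (plaqWord a ν ε).reverse)).trace ∂μ).re /
              (N : ℝ) ^ 2)) = 0 := by
  classical
  haveI : SecondCountableTopology (Matrix (Fin N) (Fin N) ℂ) :=
    inferInstanceAs (SecondCountableTopology (Fin N → Fin N → ℂ))
  haveI : SecondCountableTopology (Matrix.specialUnitaryGroup (Fin N) ℂ) :=
    Topology.IsEmbedding.subtypeVal.secondCountableTopology
  have hρ : Continuous (fundamentalRep (Fin N)) := continuous_fundamentalRep (Fin N)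
  obtain ⟨M, Q, hM, hQ, h⟩ := hμ
  haveI := h.1
  -- the two kinds of atoms: single traces and products of two traces
  have hW : ∀ v : Word d, Tendsto (fun k : ℕ =>
      (∫ V, (fundamentalRep (Fin N) (wordHolonomyZd
        (tiltedLift d i j (M k + 2) (M k + 2) (2 * (Q k + 2)) V) x v)).trace
        ∂(gibbs (fundamentalRep (Fin N)) (tiltedUnit d i j (M k + 2) (M k + 2) (2 * (Q k + 2))) β)).re)
      atTop (𝓝 (∫ U, (fundamentalRep (Fin N) (wordHolonomyZd U x v)).trace ∂μ).re) := by
    intro v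
    obtain ⟨S, hS⟩ := exists_dependsOn_wordHolonomyZd (G := Matrix.specialUnitaryGroup (Fin N) ℂ) x v
    have hc : Continuous fun U : LGConfig d (Matrix.specialUnitaryGroup (Fin N) ℂ) =>
        (fundamentalRep (Fin N) (wordHolonomyZd U x v)).trace :=
      (hρ.comp (continuous_wordHolonomyZd x v)).matrix_trace
    obtain ⟨C, hC⟩ := exists_bound_of_continuous (continuous_norm.comp hc)
    exact h.tendsto_re_integral hρ (T := S) (fun U V hUV => by simp only [hS U V hUV]) hc
      (C := C) fun U => (le_abs_self _).trans (hC U)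
  have hD : ∀ u v : Word d, Tendsto (fun k : ℕ =>
      (∫ V, (fundamentalRep (Fin N) (wordHolonomyZd
          (tiltedLift d i j (M k + 2) (M k + 2) (2 * (Q k + 2)) V) x u)).trace *
        (fundamentalRep (Fin N) (wordHolonomyZd
          (tiltedLift d i j (M k + 2) (M k + 2) (2 * (Q k + 2)) V) x v)).trace
        ∂(gibbs (fundamentalRep (Fin N)) (tiltedUnit d i j (M k + 2) (M k + 2) (2 * (Q k + 2))) β)).re)
      atTop (𝓝 (∫ U, (fundamentalRep (Fin N) (wordHolonomyZd U x u)).trace *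
        (fundamentalRep (Fin N) (wordHolonomyZd U x v)).trace ∂μ).re) := by
    intro u v
    obtain ⟨S₁, hS₁⟩ := exists_dependsOn_wordHolonomyZd (G := Matrix.specialUnitaryGroup (Fin N) ℂ) x u
    obtain ⟨S₂, hS₂⟩ := exists_dependsOn_wordHolonomyZd (G := Matrix.specialUnitaryGroup (Fin N) ℂ) x v
    have hc : Continuous fun U : LGConfig d (Matrix.specialUnitaryGroup (Fin N) ℂ) =>
        (fundamentalRep (Fin N) (wordHolonomyZd U x u)).trace *
          (fundamentalRep (Fin N) (wordHolonomyZd U x v)).trace :=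
      (hρ.comp (continuous_wordHolonomyZd x u)).matrix_trace.mul
        (hρ.comp (continuous_wordHolonomyZd x v)).matrix_trace
    obtain ⟨C, hC⟩ := exists_bound_of_continuous (continuous_norm.comp hc)
    refine h.tendsto_re_integral hρ (T := S₁ ∪ S₂) (fun U V hUV => ?_) hc
      (C := C) fun U => (le_abs_self _).trans (hC U)
    simp only [hS₁ U V fun e he => hUV e (by rw [Finset.coe_union]; exact Or.inl he),
      hS₂ U V fun e he => hUV e (by rw [Finset.coe_union]; exact Or.inr he)]
  -- the box identities, eventually (the word is small for large boxes)
  have hev : ∀ᶠ k : ℕ in atTop,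
      (∑ k' ∈ (Finset.range w.length).filter (w.fwdOccZ a),
        ((∫ V, (fundamentalRep (Fin N) (wordHolonomyZd
              (tiltedLift d i j (M k + 2) (M k + 2) (2 * (Q k + 2)) V) x (w.take k'))).trace *
            (fundamentalRep (Fin N) (wordHolonomyZd
              (tiltedLift d i j (M k + 2) (M k + 2) (2 * (Q k + 2)) V) x (w.drop k'))).trace
            ∂(gibbs (fundamentalRep (Fin N)) (tiltedUnit d i j (M k + 2) (M k + 2) (2 * (Q k + 2))) β)).re /
            (N : ℝ) ^ 2 -
          (N : ℝ)⁻¹ * (∫ V, (fundamentalRep (Fin N) (wordHolonomyZd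
              (tiltedLift d i j (M k + 2) (M k + 2) (2 * (Q k + 2)) V) x w)).trace
            ∂(gibbs (fundamentalRep (Fin N)) (tiltedUnit d i j (M k + 2) (M k + 2) (2 * (Q k + 2))) β)).re /
            (N : ℝ) ^ 2)) -
      (∑ k' ∈ (Finset.range w.length).filter (w.bwdOccZ a),
        ((∫ V, (fundamentalRep (Fin N) (wordHolonomyZd
              (tiltedLift d i j (M k + 2) (M k + 2) (2 * (Q k + 2)) V) x (w.take (k' + 1)))).trace *
            (fundamentalRep (Fin N) (wordHolonomyZd
              (tiltedLift d i j (M k + 2) (M k + 2) (2 * (Q k + 2)) V) x (w.drop (k' + 1)))).trace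
            ∂(gibbs (fundamentalRep (Fin N)) (tiltedUnit d i j (M k + 2) (M k + 2) (2 * (Q k + 2))) β)).re /
            (N : ℝ) ^ 2 -
          (N : ℝ)⁻¹ * (∫ V, (fundamentalRep (Fin N) (wordHolonomyZd
              (tiltedLift d i j (M k + 2) (M k + 2) (2 * (Q k + 2)) V) x w)).trace
            ∂(gibbs (fundamentalRep (Fin N)) (tiltedUnit d i j (M k + 2) (M k + 2) (2 * (Q k + 2))) β)).re /
            (N : ℝ) ^ 2)) +
      β / (2 * N) * ∑ ν ∈ Finset.univ.erase a, ∑ ε : Bool,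
        ((N : ℝ)⁻¹ * (∫ V, (fundamentalRep (Fin N) (wordHolonomyZd
              (tiltedLift d i j (M k + 2) (M k + 2) (2 * (Q k + 2)) V) x (w ++ plaqWord a ν ε))).trace
            ∂(gibbs (fundamentalRep (Fin N)) (tiltedUnit d i j (M k + 2) (M k + 2) (2 * (Q k + 2))) β)).re -
          (N : ℝ)⁻¹ * (∫ V, (fundamentalRep (Fin N) (wordHolonomyZd
              (tiltedLift d i j (M k + 2) (M k + 2) (2 * (Q k + 2)) V) x
                (w ++ (plaqWord a ν ε).reverse))).trace
            ∂(gibbs (fundamentalRep (Fin N)) (tiltedUnit d i j (M k + 2) (M k + 2) (2 * (Q k + 2))) β)).re -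
          ((∫ V, (fundamentalRep (Fin N) (wordHolonomyZd
                (tiltedLift d i j (M k + 2) (M k + 2) (2 * (Q k + 2)) V) x w)).trace *
              (fundamentalRep (Fin N) (wordHolonomyZd
                (tiltedLift d i j (M k + 2) (M k + 2) (2 * (Q k + 2)) V) x (plaqWord a ν ε))).trace
            ∂(gibbs (fundamentalRep (Fin N)) (tiltedUnit d i j (M k + 2) (M k + 2) (2 * (Q k + 2))) β)).re /
              (N : ℝ) ^ 2 -
            (∫ V, (fundamentalRep (Fin N) (wordHolonomyZd
                (tiltedLift d i j (M k + 2) (M k + 2) (2 * (Q k + 2)) V) x w)).trace *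
              (fundamentalRep (Fin N) (wordHolonomyZd
                (tiltedLift d i j (M k + 2) (M k + 2) (2 * (Q k + 2)) V) x
                  (plaqWord a ν ε).reverse)).trace
            ∂(gibbs (fundamentalRep (Fin N)) (tiltedUnit d i j (M k + 2) (M k + 2) (2 * (Q k + 2))) β)).re /
              (N : ℝ) ^ 2)) = 0 := by
    filter_upwards [hM.eventually_ge_atTop w.length, hQ.eventually_ge_atTop w.length] with k hkM hkQ
    have hsm := smallFor_tiltedUnit_of_dispBound d (M k + 2) (M k + 2) (2 * (Q k + 2)) hij
      (dispBound_length d w) (by omega) (by omega) (by omega)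
    have hwk : Word.endpoint (tiltedUnit d i j (M k + 2) (M k + 2) (2 * (Q k + 2)))
        (x : TiltedSite d i j (M k + 2) (M k + 2) (2 * (Q k + 2))) w = (x : TiltedSite d i j _ _ _) := by
      rw [endpoint_mk, hw]
    have hbox := loopEquation_pairForm_specialUnitaryGroup N
      (tiltedUnit d i j (M k + 2) (M k + 2) (2 * (Q k + 2))) β (x : TiltedSite d i j _ _ _) a w hwk hsm
    simpa only [wordHolonomy_mk] using hbox
  -- the limit of the left-hand sides
  have hlim := ((tendsto_finsetSum ((Finset.range w.length).filter (w.fwdOccZ a))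
      (fun k' _ => ((hD (w.take k') (w.drop k')).div_const ((N : ℝ) ^ 2)).sub
        (((hW w).const_mul ((N : ℝ)⁻¹)).div_const ((N : ℝ) ^ 2)))).sub
    (tendsto_finsetSum ((Finset.range w.length).filter (w.bwdOccZ a))
      (fun k' _ => ((hD (w.take (k' + 1)) (w.drop (k' + 1))).div_const ((N : ℝ) ^ 2)).sub
        (((hW w).const_mul ((N : ℝ)⁻¹)).div_const ((N : ℝ) ^ 2))))).add
    ((tendsto_finsetSum (Finset.univ.erase a) fun ν _ => tendsto_finsetSum Finset.univ fun ε _ =>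
      ((((hW (w ++ plaqWord a ν ε)).const_mul ((N : ℝ)⁻¹)).sub
        ((hW (w ++ (plaqWord a ν ε).reverse)).const_mul ((N : ℝ)⁻¹))).sub
        (((hD w (plaqWord a ν ε)).div_const ((N : ℝ) ^ 2)).sub
          ((hD w (plaqWord a ν ε).reverse).div_const ((N : ℝ) ^ 2))))).const_mul (β / (2 * N)))
  exact (tendsto_nhds_unique (tendsto_const_nhds.congr' (hev.mono fun k hk => hk.symm)) hlim).symm

end LoopEquation

end TiltedRP

end Summit.QuantumFields.GaugeBoot
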